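import Summits.ResolutionOfSingularities.ResolutionOfSingularities.Theorems.HomologicalConductorNoZenoRationalAscentProjectiveModel
import Summits.ResolutionOfSingularities.ResolutionOfSingularities.Theorems.HomologicalConductorNoZenoRationalAscentRegularBase
import HarnessLib

/-!
# Crux `NoZenoR` (stmt-ResolutionOfSingularities-19943) — Lipman (1.2) 1) in RING FORM over a regular base, MODULO B):
# the drop-in for `NoZeno.SandwichCluster.hasRationalSingularity_of_isLocalization` with `Lipman1969_1_2 ↦ Lipman1969_1_2_B`

Route `ResolutionOfSingularities/HomologicalConductor` (cell decomp-res, hand leafhand-res-homologicalconduct-12 g1).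
OURS: AI-written, weaker than expert review; nothing here is a statement of the manuscript under review (Hironaka 2017).
SUPPORT level (`--supports stmt-19943`), counted 0.  Def-free.  Named fact consumed: ONLY the hypothesis
`(hB : Lipman1969_1_2_B)` (statement B) of Lipman's proof of (1.2), a special case of Zariski's Theorem (26.1)).

`NoZeno.SandwichCluster.hasRationalSingularity_of_isLocalization (h12 : Lipman1969_1_2)` («rational singularities ascend to
normal two-dimensional local rings of birational affine models», Lipman Prop. (1.2) 1) in ring form) is consumed by the W4.4
chain only through `hasRationalSingularity_tower`, where the base `R` is the REGULAR ring of the sandwich context.  Here is the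
same conclusion over a regular `R` with `h12` replaced by `hB` (hand leafhand-res-homologicalconduct-11 did the same for the
part 2) consumer `Lipman1969_1_2.hasTrivialCechH1_of_isResolution ↦ Lipman1969_1_2_B.hasTrivialCechH1_of_isResolution`), at
the price of ONE extra hypothesis the call site can supply: a basic open `D(s) ∋ 𝔮` of `Spec B` all of whose points other
than `𝔮` are REGULAR (at the call site `T_m = B_𝔮` is an isolated singularity of an excellent surface, so the singular locus
of `Spec B` near `𝔮` is `{𝔮}`; `Resolution.isOpen_regularLocus_of_locallyOfFiniteType_field`).  The normality of `T` and
`dim T = 2` of the original are used only to make `𝔮` a closed point of the projective model.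

Proof = Lipman's (p. 200 with footnote (1)): projective model `W* ⊇ Spec B` (`exists_projectiveModel_of_isAffine`), then
`hasRationalSingularity_stalk_of_regular_off_point_of_B` at `w = 𝔮 ∈ W*`, and `𝒪_{W*,w} ≅ 𝒪_{Spec B,𝔮} ≅ B_𝔮 = T`.

* `hasRationalSingularity_of_isLocalization_of_B`.

No crux, kill test or summit statement is proved; resolution of singularities in positive characteristic is NOT proved.

## References
* J. Lipman, *Rational singularities …*, Publ. Math. IHÉS 36 (1969): Prop. (1.2) 1) and its proof, p. 200 with footnote (1);
  statement B) (p. 200). [Lipman1969]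
-/

noncomputable section

-- single-problem summit: the doubled namespace component `ResolutionOfSingularities` is forced
set_option linter.dupNamespace false

namespace Summit.ResolutionOfSingularities.ResolutionOfSingularities.Theorems.NoZeno.RationalAscent

open CategoryTheory CategoryTheory.Limits AlgebraicGeometry TopologicalSpace IsLocalRing Opposite
open Literature.AlgebraicGeometry.Resolution Literature.AlgebraicGeometry.Morphisms
open Summit.ResolutionOfSingularities.ResolutionOfSingularities.Theorems.SurfaceTermination.GenusDescent
open Summit.ResolutionOfSingularities.ResolutionOfSingularities.Theorems.NoZeno.SandwichCluster

/-- **Lipman (1.2) 1) in ring form over a REGULAR base, MODULO statement B)** — drop-in for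
`NoZeno.SandwichCluster.hasRationalSingularity_of_isLocalization` with `Lipman1969_1_2` replaced by `Lipman1969_1_2_B`:
`R` a regular local ring of dimension `2`, `B ⊇ R` a finitely generated `R`-algebra and a domain with a common denominator
`r ≠ 0` (a birational affine model `Spec B → Spec R`), `𝔮` a prime of `B` with `dim B_𝔮 = 2`, and a basic open `D(s) ∋ 𝔮`
all of whose other points are regular; then `T = B_𝔮` has a rational singularity (a desingularization with `H¹ = 0`).
[cite: Lipman1969, Proposition (1.2) 1), proof p. 200 with footnote (1); statement B) (p. 200)] -/
theorem hasRationalSingularity_of_isLocalization_of_B (hB : Lipman1969_1_2_B.{0}) {R B T : Type}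
    [CommRing R] [IsDomain R] [IsRegularLocalRing R] (hdimR : ringKrullDim R = 2)
    [CommRing B] [IsDomain B] [Algebra R B] [Algebra.FiniteType R B]
    (hinj : Function.Injective (algebraMap R B)) (r : R) (hr : r ≠ 0)
    (hden : ∀ b : B, ∃ n : ℕ, ∃ a : R, algebraMap R B a = algebraMap R B r ^ n * b)
    (𝔮 : Ideal B) [𝔮.IsPrime] [CommRing T] [Algebra B T] [IsLocalization.AtPrime T 𝔮]
    (hdimT : ringKrullDim T = 2)
    -- the punctured-regular basic open neighbourhood of `𝔮`
    (s : B) (hs : s ∉ 𝔮)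
    (hreg : ∀ 𝔭 : Ideal B, [𝔭.IsPrime] → s ∉ 𝔭 → 𝔭 ≠ 𝔮 → IsRegularLocalRing (Localization.AtPrime 𝔭)) :
    HasRationalSingularity T := by
  classical
  haveI : IsDomain (CommRingCat.of B) := ‹IsDomain B›
  haveI : IsNoetherianRing (CommRingCat.of R) := (inferInstance : IsNoetherianRing R)
  -- the birational affine model `g : Spec B → Spec R`
  let g : Spec (.of B) ⟶ Spec (.of R) := Spec.map (CommRingCat.ofHom (algebraMap R B))
  haveI : LocallyOfFiniteType g := by
    rw [HasRingHomProperty.Spec_iff (P := @LocallyOfFiniteType)]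
    exact RingHom.finiteType_algebraMap.mpr ‹Algebra.FiniteType R B›
  have hbir : IsBirational g := isBirational_specMap_of_denominator hinj r hr hden
  -- its projective model `W`
  obtain ⟨W, hWint, j, hj, gW, hgW, hjg, hproj, hbirW⟩ := exists_projectiveModel_of_isAffine g hbir
  haveI := hWint
  haveI := hj
  haveI := hgW
  haveI : IsLocallyNoetherian W := LocallyOfFiniteType.isLocallyNoetherian gW
  haveI : CompactSpace W := QuasiCompact.compactSpace_of_compactSpace gW
  haveI : IsNoetherian W := {}
  -- the point `w = 𝔮` and the identification `𝒪_{W,w} ≅ 𝒪_{Spec B,𝔮} ≅ T`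
  let y : Spec (.of B) := ⟨𝔮, ‹𝔮.IsPrime›⟩
  letI : Algebra B ((Spec (.of B)).presheaf.stalk y) := StructureSheaf.stalkAlgebra B y
  haveI : IsLocalization.AtPrime ((Spec (.of B)).presheaf.stalk y) 𝔮 :=
    StructureSheaf.IsLocalization.to_stalk B y
  let e₂ : (Spec (.of B)).presheaf.stalk y ≃ₐ[B] T := IsLocalization.algEquiv 𝔮.primeCompl _ _
  let e₁ : W.presheaf.stalk (j y) ≅ (Spec (.of B)).presheaf.stalk y := asIso (j.stalkMap y)
  let e : W.presheaf.stalk (j y) ≃+* T := e₁.commRingCatIsoToRingEquiv.trans e₂.toRingEquiv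
  have hdimw : ringKrullDim (W.presheaf.stalk (j y)) = 2 := by
    rw [ringKrullDim_eq_of_ringEquiv e]; exact hdimT
  -- `w` is a closed point: `coheight w = dim 𝒪_{W,w} = 2 = dim W`
  have hdimWtop : topologicalKrullDim W ≤ 2 := by
    refine hbirW.topologicalKrullDim_le_of_isNoetherian.trans ?_
    change topologicalKrullDim (PrimeSpectrum R) ≤ 2
    rw [PrimeSpectrum.topologicalKrullDim_eq_ringKrullDim]
    exact hdimR.le
  have hw : IsClosed ({j y} : Set W) := by
    refine isClosed_singleton_of_two_le_coheight hdimWtop (le_of_eq ?_)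
    have h2 : ((Order.coheight (j y) : ℕ∞) : WithBot ℕ∞) = ((2 : ℕ∞) : WithBot ℕ∞) := by
      rw [← ringKrullDim_stalk_eq_coheight, hdimw]; rfl
    exact (WithBot.coe_injective h2).symm
  -- the punctured-regular neighbourhood `V = j(D(s))`
  let D : (Spec (.of B)).Opens := PrimeSpectrum.basicOpen s
  have hyD : y ∈ D := hs
  have hwV : j y ∈ j ''ᵁ D := ⟨y, hyD, rfl⟩
  have hreg' : ∀ x ∈ j ''ᵁ D, x ≠ j y → IsRegularLocalRing (W.presheaf.stalk x) := by
    rintro _ ⟨x, hx, rfl⟩ hne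
    have hx𝔮 : x.asIdeal ≠ 𝔮 := fun h => by
      have hxy : x = y := PrimeSpectrum.ext h
      subst hxy
      exact hne rfl
    have hsx : s ∉ x.asIdeal := hx
    haveI := hreg x.asIdeal hsx hx𝔮
    letI : Algebra B ((Spec (.of B)).presheaf.stalk x) := StructureSheaf.stalkAlgebra B x
    haveI : IsLocalization.AtPrime ((Spec (.of B)).presheaf.stalk x) x.asIdeal :=
      StructureSheaf.IsLocalization.to_stalk B x
    let ex : Localization.AtPrime x.asIdeal ≃ₐ[B] (Spec (.of B)).presheaf.stalk x :=
      IsLocalization.algEquiv x.asIdeal.primeCompl _ _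
    haveI : IsRegularLocalRing ((Spec (.of B)).presheaf.stalk x) := IsRegularLocalRing.of_ringEquiv ex.toRingEquiv
    exact IsRegularLocalRing.of_ringEquiv (asIso (j.stalkMap x)).commRingCatIsoToRingEquiv.symm
  -- Lipman (1.2) 1) at the closed point of the projective model, mod B), and transport to `T`
  have hrat : HasRationalSingularity (W.presheaf.stalk (j y)) :=
    hasRationalSingularity_stalk_of_regular_off_point_of_B hB hdimR gW hbirW hproj (j y) hw (j ''ᵁ D) hwV hreg'
  exact HasRationalSingularity.of_ringEquiv e hrat

end Summit.ResolutionOfSingularities.ResolutionOfSingularities.Theorems.NoZeno.RationalAscent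

end
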